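import Literature.Analysis.FunctionSpaces.TorusSobolevL6
import HarnessLib

/-!
# The Sobolev embedding `H²(T³) ⊂ L^∞(T³)` for smooth fields, with a constant

Analysis/FunctionSpaces support file (everything proved; no definitions, no named facts), sequel of
`TorusSobolevL6.lean` (`H¹ ⊂ L⁶` on `T³`) and `TorusPoincareMorrey.lean` (Morrey's inequality on
`T^d`). It supplies the sup-norm form of the Sobolev imbedding theorem in the case `m = p = 2`,
`n = 3` (Adams 1975, Thm. 5.4 Part I Case C, `mp > n`: `W^{m,p} → C_B`; Lemma 5.15: Morrey's
estimate in `W^{1,r}`, `r = np/(n - p) = 6 > n`, composed with `W^{2,2} ⊂ W^{1,6}`), on the flat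
three-dimensional torus and for smooth maps into a finite-dimensional real normed space `F'`:

* `Torus.enorm_sq_le_sobolev_two_of_isSmooth` — on `T^d` with `card d = 3` there is `K`
  (depending only on `d` and `F'`) with
  `‖f x‖² ≤ K (∫ ‖f‖² + Σᵢ ∫ ‖∂ᵢ f‖² + Σᵢ Σⱼ ∫ ‖∂ᵢ ∂ⱼ f‖²)` for every smooth `f : T^d → F'` and
  every `x`, in `ℝ≥0∞` form (lower Lebesgue integrals of `‖·‖ₑ²`);
* `Torus.norm_sq_le_sobolev_two_of_isSmooth` — the same with Bochner integrals of the
  (continuous, hence integrable) densities and a real constant `K > 0`;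
* `Torus.exists_norm_sq_le_sobolev_two` — the instance `d = Fin 3` for maps into a
  finite-dimensional inner product space (the form consumed by the hydrodynamic-limit files,
  where it converts `H³` energies into `C¹` sup bounds).

Proof (the printed chain of Adams' Lemma 5.15 with `j = 1`, `r = 6`): write
`f x = (f x - ∫ f) + ∫ f`; Morrey's inequality with `q = 6 > 3`
(`Torus.enorm_sub_integral_le`) gives `‖f x - ∫ f‖ ≤ 6 ‖Df‖_{L⁶}`, and
`‖∫ f‖ ≤ ‖f‖_{L¹} ≤ ‖f‖_{L²}` on the probability space `T^d`; then
`‖Df‖_{L⁶} ≤ Σⱼ ‖∂ⱼ f‖_{L⁶}` (`Torus.eLpNorm_norm_fderiv_le_sum`), the embedding `H¹ ⊂ L⁶`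
(`Torus.lintegral_enorm_pow_six_le_cube_of_isSmooth`) applied to each smooth `∂ⱼ f` gives
`‖∂ⱼ f‖²_{L⁶} ≤ K₁^{1/3} (∫ ‖∂ⱼ f‖² + ∫ ‖D ∂ⱼ f‖²)`, and `‖D ∂ⱼ f‖² ≤ 3 Σᵢ ‖∂ᵢ ∂ⱼ f‖²` pointwise
(`Torus.norm_fderiv_sq_le_card_mul_sum`). Constants are existential and not tracked.

## Mathlib / tree search

Mathlib (this pin): GNS on `ℝⁿ` (`eLpNorm_le_eLpNorm_fderiv_of_le`), no Morrey inequality, nothing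
periodic. Tree: `SobolevImbeddingSup` (`W^{2,2}(ℝ³) ⊂ C_B` for `C²` maps on a `3`-space,
`exists_enorm_le_sobolev_two_two_dim_three`), `TorusPoincareMorrey` (Morrey on `T^d`),
`TorusSobolevL6` (`H¹ ⊂ L⁶` on `T³`), `TorusInverseLaplacianSup` / `TorusAgmonLatticeSum`
(Fourier-side sup bounds for `Δ⁻¹` and Agmon's lattice sum); no `H² ⊂ L^∞` statement on the
torus in terms of partial derivatives (searched `norm_sq_le_sobolev`, `le_sobolev_two`, `Agmon`
under `FunctionSpaces/Torus*`).

## References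

* R. A. Adams, *Sobolev Spaces*, Academic Press 1975, Thm. 5.4 Part I Case C and Lemma 5.15
  (pp. 97–98). [Adams1975]
* L. C. Evans, *Partial Differential Equations*, 2nd ed., AMS 2010, §5.6.2 Thm. 4 (Morrey),
  §5.6.3 Thm. 6 (general Sobolev inequalities, `k > n/p`). [Evans2010]
-/

noncomputable section

open MeasureTheory Set Filter Function
open scoped ENNReal NNReal ContDiff

namespace Literature.Analysis.FunctionSpaces

namespace Torus

variable {d : Type*} [Fintype d] [DecidableEq d]
variable {F' : Type*} [NormedAddCommGroup F'] [NormedSpace ℝ F'] [FiniteDimensional ℝ F']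

omit [DecidableEq d] [NormedSpace ℝ F'] [FiniteDimensional ℝ F'] in
/-- `∫⁻ ‖g‖ₑ² = ofReal (∫ ‖g‖²)` for continuous `g` on the (compact) torus (private copy of
`Torus.lintegral_enorm_sq_eq_ofReal_integral` of `TorusEnstrophyTrilinear`, not imported here).
[folklore] -/
private theorem lintegral_enorm_sq_eq_ofReal_integral_norm_sq {g : UnitAddTorus d → F'}
    (hg : Continuous g) :
    ∫⁻ y, ‖g y‖ₑ ^ 2 = ENNReal.ofReal (∫ y, ‖g y‖ ^ 2) := by
  have hi : Integrable (fun y => ‖g y‖ ^ 2) volume := (hg.norm.pow 2).integrable_unitAddTorus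
  rw [ofReal_integral_eq_lintegral_ofReal hi (ae_of_all _ fun y => sq_nonneg _)]
  exact lintegral_congr fun y => by rw [← ofReal_norm, ENNReal.ofReal_pow (norm_nonneg _)]

omit [DecidableEq d] [NormedSpace ℝ F'] [FiniteDimensional ℝ F'] in
/-- From `∫ ‖v‖⁶ ≤ K S³` to `‖v‖²_{L⁶} ≤ K^{1/3} S` (cube roots in `ℝ≥0∞`). [folklore] -/
theorem eLpNorm_six_sq_le_of_lintegral_pow_six_le {v : UnitAddTorus d → F'} {K : ℝ≥0} {S : ℝ≥0∞}
    (h : ∫⁻ x, ‖v x‖ₑ ^ 6 ≤ K * S ^ 3) :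
    eLpNorm v 6 volume ^ 2 ≤ ((K ^ (1 / 3 : ℝ) : ℝ≥0) : ℝ≥0∞) * S := by
  rw [eLpNorm_eq_lintegral_rpow_enorm_toReal (by norm_num) ENNReal.ofNat_ne_top,
    ENNReal.toReal_ofNat]
  have e6 : ∀ y : ℝ≥0∞, y ^ (6 : ℝ) = y ^ 6 := fun y => ENNReal.rpow_ofNat y 6
  simp_rw [e6]
  rw [← ENNReal.rpow_two, ← ENNReal.rpow_mul, show (1 / (6 : ℝ) * 2) = 1 / 3 by norm_num]
  calc (∫⁻ x, ‖v x‖ₑ ^ 6) ^ (1 / 3 : ℝ) ≤ ((K : ℝ≥0∞) * S ^ 3) ^ (1 / 3 : ℝ) :=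
        ENNReal.rpow_le_rpow h (by norm_num)
    _ = (K : ℝ≥0∞) ^ (1 / 3 : ℝ) * (S ^ 3) ^ (1 / 3 : ℝ) :=
        ENNReal.mul_rpow_of_nonneg _ _ (by norm_num)
    _ = ((K ^ (1 / 3 : ℝ) : ℝ≥0) : ℝ≥0∞) * S := by
        rw [ENNReal.coe_rpow_of_nonneg _ (by norm_num : (0 : ℝ) ≤ 1 / 3),
          show S ^ 3 = S ^ ((3 : ℕ) : ℝ) from (ENNReal.rpow_natCast S 3).symm, ← ENNReal.rpow_mul]
        norm_num

omit [DecidableEq d] in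
/-- `(Σⱼ gⱼ)² ≤ 3 Σⱼ gⱼ²` over an index type with three elements (Cauchy–Schwarz / power means in
`ℝ≥0∞`). [folklore] -/
theorem sq_sum_le_three_mul_sum_sq (hd : Fintype.card d = 3) (g : d → ℝ≥0∞) :
    (∑ j, g j) ^ 2 ≤ 3 * ∑ j, g j ^ 2 := by
  have h := ENNReal.rpow_sum_le_const_mul_sum_rpow (s := (Finset.univ : Finset d)) (f := g)
    (p := 2) (by norm_num)
  rw [Finset.card_univ, hd] at h
  norm_num at h
  simpa only [ENNReal.rpow_two] using h

/-- **The Sobolev embedding `H²(T³) ⊂ L^∞(T³)` for smooth fields, `ℝ≥0∞` form** (Adams 1975,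
Thm. 5.4 Part I Case C with `m = p = 2`, `n = 3`, via Lemma 5.15: Morrey in `W^{1,6}` after
`W^{2,2} ⊂ W^{1,6}`): on `T^d` with `card d = 3` there is `K` (depending only on `d` and the
finite-dimensional target `F'`) such that for every smooth `f : T^d → F'` and every `x`,
`‖f x‖² ≤ K (∫ ‖f‖² + Σᵢ ∫ ‖∂ᵢ f‖² + Σᵢ Σⱼ ∫ ‖∂ᵢ ∂ⱼ f‖²)`. Proof: `f x = (f x - ∫ f) + ∫ f`,
Morrey with `q = 6` (`Torus.enorm_sub_integral_le`), `‖∫ f‖ ≤ ‖f‖_{L²}`,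
`‖Df‖_{L⁶} ≤ Σⱼ ‖∂ⱼ f‖_{L⁶}`, `H¹ ⊂ L⁶` for each `∂ⱼ f`
(`Torus.lintegral_enorm_pow_six_le_cube_of_isSmooth`) and `‖D∂ⱼf‖² ≤ 3 Σᵢ ‖∂ᵢ∂ⱼ f‖²`.
[cite: Adams1975, Thm. 5.4 Part I Case C (mp > n) and Lemma 5.15] -/
theorem enorm_sq_le_sobolev_two_of_isSmooth (hd : Fintype.card d = 3) :
    ∃ K : ℝ≥0, ∀ f : UnitAddTorus d → F', IsSmooth f → ∀ x,
      ‖f x‖ₑ ^ 2 ≤ K * ((∫⁻ y, ‖f y‖ₑ ^ 2) + (∑ i, ∫⁻ y, ‖partialDeriv i f y‖ₑ ^ 2) +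
        ∑ i, ∑ j, ∫⁻ y, ‖partialDeriv i (partialDeriv j f) y‖ₑ ^ 2) := by
  obtain ⟨K₁, hK₁⟩ := lintegral_enorm_pow_six_le_cube_of_isSmooth (F' := F') hd
  set κ : ℝ≥0 := K₁ ^ (1 / 3 : ℝ) with hκ
  refine ⟨4 + 1728 * κ, fun f hf x => ?_⟩
  haveI : CompleteSpace F' := FiniteDimensional.complete ℝ F'
  have hf1 : IsContDiff 1 f := hf.isContDiff (by simp)
  have hfc : Continuous f := hf.continuous
  -- ### notation
  set A : ℝ≥0∞ := ∫⁻ y, ‖f y‖ₑ ^ 2 with hA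
  set B : d → ℝ≥0∞ := fun j => ∫⁻ y, ‖partialDeriv j f y‖ₑ ^ 2 with hB
  set C : d → d → ℝ≥0∞ := fun i j => ∫⁻ y, ‖partialDeriv i (partialDeriv j f) y‖ₑ ^ 2 with hC
  set T : ℝ≥0∞ := A + ∑ i, B i + ∑ i, ∑ j, C i j with hT
  set N : ℝ≥0∞ := eLpNorm (fun z => ‖Torus.fderiv f z‖) 6 volume with hN
  set Nn : d → ℝ≥0∞ := fun j => eLpNorm (partialDeriv j f) 6 volume with hNn
  -- ### Morrey with `q = 6`: `‖f x - ∫ f‖ ≤ 6 ‖Df‖_{L⁶}`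
  have hP : ‖f x - ∫ z, f z‖ₑ ≤ 6 * N := by
    have hd' : (Fintype.card d : ℝ) = 3 := by exact_mod_cast hd
    have h := enorm_sub_integral_le hf1 (q := 6) (by norm_num) (by rw [hd']; norm_num) x
    rw [hd] at h
    have e : ((3 : ℕ) : ℝ≥0∞) * ENNReal.ofReal (6 / (6 - ((3 : ℕ) : ℝ))) = 6 := by
      rw [show (6 : ℝ) / (6 - ((3 : ℕ) : ℝ)) = 2 by norm_num, ENNReal.ofReal_ofNat]
      norm_num
    rw [e, ENNReal.ofReal_ofNat] at h
    exact h
  -- ### `‖Df‖_{L⁶} ≤ Σⱼ ‖∂ⱼ f‖_{L⁶}`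
  have hNsum : N ≤ ∑ j, Nn j := by
    have h := eLpNorm_norm_fderiv_le_sum hf1 (p := 6) (by norm_num)
    exact h
  -- ### the mean: `‖∫ f‖² ≤ ∫ ‖f‖²`
  have hQ : ‖∫ z, f z‖ₑ ^ 2 ≤ A := by
    have h1 : ‖∫ z, f z‖ₑ ≤ eLpNorm f 2 volume :=
      calc ‖∫ z, f z‖ₑ ≤ ∫⁻ y, ‖f y‖ₑ := enorm_integral_le_lintegral_enorm _
        _ = eLpNorm f 1 volume := eLpNorm_one_eq_lintegral_enorm.symm
        _ ≤ eLpNorm f 2 volume :=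
            eLpNorm_le_eLpNorm_of_exponent_le (by norm_num) hfc.aestronglyMeasurable
    calc ‖∫ z, f z‖ₑ ^ 2 ≤ eLpNorm f 2 volume ^ 2 := by gcongr
      _ = A := eLpNorm_two_pow_two_eq_lintegral f
  -- ### `H¹ ⊂ L⁶` for each `∂ⱼ f`, and `‖D ∂ⱼ f‖² ≤ 3 Σᵢ ‖∂ᵢ ∂ⱼ f‖²`
  have hNn_le : ∀ j, Nn j ^ 2 ≤ κ * (B j + 3 * ∑ i, C i j) := by
    intro j
    have hg : IsSmooth (partialDeriv j f) := hf.partialDeriv j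
    have hg1 : IsContDiff 1 (partialDeriv j f) := hg.isContDiff (by simp)
    -- pointwise operator-norm bound, in `ℝ≥0∞`
    have hpt : ∀ y, ‖Torus.fderiv (partialDeriv j f) y‖ₑ ^ 2 ≤
        3 * ∑ i, ‖partialDeriv i (partialDeriv j f) y‖ₑ ^ 2 := by
      intro y
      have h := norm_fderiv_sq_le_card_mul_sum hg1 y
      rw [hd] at h
      push_cast at h
      rw [← ofReal_norm, ← ENNReal.ofReal_pow (norm_nonneg _)]
      refine (ENNReal.ofReal_le_ofReal h).trans (le_of_eq ?_)
      rw [ENNReal.ofReal_mul (by norm_num), ENNReal.ofReal_ofNat,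
        ENNReal.ofReal_sum_of_nonneg (fun i _ => sq_nonneg _)]
      congr 1
      refine Finset.sum_congr rfl fun i _ => ?_
      rw [ENNReal.ofReal_pow (norm_nonneg _), ofReal_norm]
    have hmeas : ∀ i, Measurable fun y => ‖partialDeriv i (partialDeriv j f) y‖ₑ ^ 2 :=
      fun i => (hg.partialDeriv i).continuous.enorm.measurable.pow_const 2
    have hb : ∫⁻ y, ‖Torus.fderiv (partialDeriv j f) y‖ₑ ^ 2 ≤ 3 * ∑ i, C i j := by
      calc ∫⁻ y, ‖Torus.fderiv (partialDeriv j f) y‖ₑ ^ 2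
          ≤ ∫⁻ y, 3 * ∑ i, ‖partialDeriv i (partialDeriv j f) y‖ₑ ^ 2 := lintegral_mono hpt
        _ = 3 * ∑ i, C i j := by
            rw [lintegral_const_mul _ (Finset.measurable_sum _ fun i _ => hmeas i),
              lintegral_finsetSum _ fun i _ => hmeas i]
    calc Nn j ^ 2 ≤ κ * (B j + ∫⁻ y, ‖Torus.fderiv (partialDeriv j f) y‖ₑ ^ 2) :=
          eLpNorm_six_sq_le_of_lintegral_pow_six_le (hK₁ _ hg)
      _ ≤ κ * (B j + 3 * ∑ i, C i j) := by gcongr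
  -- ### assembly (`(a + b)² ≤ 4 (a² + b²)`, crude, as in `TorusSobolevL4`)
  have hsq4 : ∀ a b : ℝ≥0∞, (a + b) ^ 2 ≤ 4 * (a ^ 2 + b ^ 2) := by
    intro a b
    rcases le_total a b with h | h
    · calc (a + b) ^ 2 ≤ (b + b) ^ 2 := by gcongr
        _ = 4 * b ^ 2 := by ring
        _ ≤ 4 * (a ^ 2 + b ^ 2) := by gcongr; exact le_add_self
    · calc (a + b) ^ 2 ≤ (a + a) ^ 2 := by gcongr
        _ = 4 * a ^ 2 := by ring
        _ ≤ 4 * (a ^ 2 + b ^ 2) := by gcongr; exact le_self_add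
  have hAT : A ≤ T := le_add_right le_self_add
  have hBT : ∑ j, B j ≤ T := le_add_right le_add_self
  have hCT : ∑ j, ∑ i, C i j ≤ T := by rw [Finset.sum_comm]; exact le_add_self
  have hsplit : ‖f x‖ₑ ≤ ‖f x - ∫ z, f z‖ₑ + ‖∫ z, f z‖ₑ := by
    conv_lhs => rw [← sub_add_cancel (f x) (∫ z, f z)]
    exact enorm_add_le _ _
  calc ‖f x‖ₑ ^ 2 ≤ (‖f x - ∫ z, f z‖ₑ + ‖∫ z, f z‖ₑ) ^ 2 := by gcongr
    _ ≤ 4 * (‖f x - ∫ z, f z‖ₑ ^ 2 + ‖∫ z, f z‖ₑ ^ 2) := hsq4 _ _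
    _ ≤ 4 * ((6 * N) ^ 2 + A) := by gcongr
    _ ≤ 4 * ((6 * ∑ j, Nn j) ^ 2 + A) := by gcongr
    _ = 144 * (∑ j, Nn j) ^ 2 + 4 * A := by ring
    _ ≤ 144 * (3 * ∑ j, Nn j ^ 2) + 4 * A := by gcongr; exact sq_sum_le_three_mul_sum_sq hd _
    _ ≤ 144 * (3 * ∑ j, (κ : ℝ≥0∞) * (B j + 3 * ∑ i, C i j)) + 4 * A := by
        gcongr with j _
        exact hNn_le j
    _ = 4 * A + 432 * κ * ∑ j, B j + 1296 * κ * ∑ j, ∑ i, C i j := by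
        rw [← Finset.mul_sum, Finset.sum_add_distrib, ← Finset.mul_sum]
        ring
    _ ≤ 4 * T + 432 * κ * T + 1296 * κ * T := by gcongr
    _ = ((4 + 1728 * κ : ℝ≥0) : ℝ≥0∞) * T := by
        push_cast
        ring

/-- **The Sobolev embedding `H²(T³) ⊂ L^∞(T³)` for smooth fields, Bochner form** (Adams 1975,
Thm. 5.4 Part I Case C, `m = p = 2`, `n = 3`): on `T^d` with `card d = 3` there is a real `K > 0`
such that for every smooth `f : T^d → F'` and every `x`,
`‖f x‖² ≤ K (∫ ‖f‖² + Σᵢ ∫ ‖∂ᵢ f‖² + Σᵢ Σⱼ ∫ ‖∂ᵢ ∂ⱼ f‖²)` with the Bochner integrals of the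
continuous densities (from `enorm_sq_le_sobolev_two_of_isSmooth`).
[cite: Adams1975, Thm. 5.4 Part I Case C (mp > n) and Lemma 5.15] -/
theorem norm_sq_le_sobolev_two_of_isSmooth (hd : Fintype.card d = 3) :
    ∃ K : ℝ, 0 < K ∧ ∀ f : UnitAddTorus d → F', IsSmooth f → ∀ x,
      ‖f x‖ ^ 2 ≤ K * ((∫ y, ‖f y‖ ^ 2) + (∑ i, ∫ y, ‖partialDeriv i f y‖ ^ 2) +
        ∑ i, ∑ j, ∫ y, ‖partialDeriv i (partialDeriv j f) y‖ ^ 2) := by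
  obtain ⟨K, hK⟩ := enorm_sq_le_sobolev_two_of_isSmooth (F' := F') hd
  refine ⟨K + 1, by positivity, fun f hf x => ?_⟩
  have h := hK f hf x
  set a : ℝ := ∫ y, ‖f y‖ ^ 2 with ha
  set b : d → ℝ := fun i => ∫ y, ‖partialDeriv i f y‖ ^ 2 with hb
  set c : d → d → ℝ := fun i j => ∫ y, ‖partialDeriv i (partialDeriv j f) y‖ ^ 2 with hc
  have ha0 : 0 ≤ a := integral_nonneg fun _ => sq_nonneg _
  have hb0 : ∀ i, 0 ≤ b i := fun i => integral_nonneg fun _ => sq_nonneg _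
  have hc0 : ∀ i j, 0 ≤ c i j := fun i j => integral_nonneg fun _ => sq_nonneg _
  have hsb0 : 0 ≤ ∑ i, b i := Finset.sum_nonneg fun i _ => hb0 i
  have hsc0 : ∀ i, 0 ≤ ∑ j, c i j := fun i => Finset.sum_nonneg fun j _ => hc0 i j
  have hssc0 : 0 ≤ ∑ i, ∑ j, c i j := Finset.sum_nonneg fun i _ => hsc0 i
  have hT0 : 0 ≤ a + ∑ i, b i + ∑ i, ∑ j, c i j := by positivity
  -- the densities as `ofReal` of real integrals
  have eA : ∫⁻ y, ‖f y‖ₑ ^ 2 = ENNReal.ofReal a :=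
    lintegral_enorm_sq_eq_ofReal_integral_norm_sq hf.continuous
  have eB : ∑ i, ∫⁻ y, ‖partialDeriv i f y‖ₑ ^ 2 = ENNReal.ofReal (∑ i, b i) := by
    rw [ENNReal.ofReal_sum_of_nonneg fun i _ => hb0 i]
    exact Finset.sum_congr rfl fun i _ =>
      lintegral_enorm_sq_eq_ofReal_integral_norm_sq (hf.partialDeriv i).continuous
  have eC : ∑ i, ∑ j, ∫⁻ y, ‖partialDeriv i (partialDeriv j f) y‖ₑ ^ 2 =
      ENNReal.ofReal (∑ i, ∑ j, c i j) := by
    rw [ENNReal.ofReal_sum_of_nonneg fun i _ => hsc0 i]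
    refine Finset.sum_congr rfl fun i _ => ?_
    rw [ENNReal.ofReal_sum_of_nonneg fun j _ => hc0 i j]
    exact Finset.sum_congr rfl fun j _ =>
      lintegral_enorm_sq_eq_ofReal_integral_norm_sq ((hf.partialDeriv j).partialDeriv i).continuous
  have eL : ‖f x‖ₑ ^ 2 = ENNReal.ofReal (‖f x‖ ^ 2) := by
    rw [← ofReal_norm, ENNReal.ofReal_pow (norm_nonneg _)]
  rw [eA, eB, eC, eL, ← ENNReal.ofReal_add ha0 hsb0, ← ENNReal.ofReal_add (by positivity) hssc0,
    ← ENNReal.ofReal_coe_nnreal, ← ENNReal.ofReal_mul (NNReal.coe_nonneg K),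
    ENNReal.ofReal_le_ofReal_iff (mul_nonneg (NNReal.coe_nonneg K) hT0)] at h
  calc ‖f x‖ ^ 2 ≤ K * (a + ∑ i, b i + ∑ i, ∑ j, c i j) := h
    _ ≤ (K + 1) * (a + ∑ i, b i + ∑ i, ∑ j, c i j) :=
        mul_le_mul_of_nonneg_right (le_add_of_nonneg_right zero_le_one) hT0

end Torus

/-- **`H²(𝕋³) ⊂ L^∞(𝕋³)` with a constant, for smooth maps into a finite-dimensional inner product
space** (Adams 1975, Thm. 5.4 Part I Case C, `m = p = 2`, `n = 3`; the instance `d = Fin 3` of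
`Torus.norm_sq_le_sobolev_two_of_isSmooth`): there is `K > 0` with
`‖f x‖² ≤ K (∫ ‖f‖² + Σᵢ ∫ ‖∂ᵢ f‖² + Σᵢ Σⱼ ∫ ‖∂ᵢ ∂ⱼ f‖²)` for every smooth `f : 𝕋³ → F'` and
every `x ∈ 𝕋³`. [cite: Adams1975, Thm. 5.4 Part I Case C (mp > n) and Lemma 5.15] -/
theorem Torus.exists_norm_sq_le_sobolev_two (F' : Type*) [NormedAddCommGroup F']
    [InnerProductSpace ℝ F'] [FiniteDimensional ℝ F'] :
    ∃ K : ℝ, 0 < K ∧ ∀ f : UnitAddTorus (Fin 3) → F', Torus.IsSmooth f → ∀ x,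
      ‖f x‖ ^ 2 ≤ K * ((∫ y, ‖f y‖ ^ 2) + (∑ i, ∫ y, ‖Torus.partialDeriv i f y‖ ^ 2) +
        ∑ i, ∑ j, ∫ y, ‖Torus.partialDeriv i (Torus.partialDeriv j f) y‖ ^ 2) :=
  Torus.norm_sq_le_sobolev_two_of_isSmooth (d := Fin 3) (Fintype.card_fin 3)

end Literature.Analysis.FunctionSpaces

end
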